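import Literature.MathematicalPhysics.QuantumFieldTheory.Balaban1983to89.B9Thm31SiteGsqHessianDecayBudgetsReg335Y

/-!
# `Balaban1983to89.B9Thm31SiteGsqHessianDecayReg335Y` — T. Bałaban, *Propagators for lattice gauge theories in a background field*, Commun. Math. Phys. **99** (1985)
# 389–434 [Balaban1985BackgroundPropagators] (3.46) p. 398 (sixth member `|∇_U∇_UG′(U)λ| ≤ B₀e^{−δ₀d(y,y′)}|λ|`, NO level factor), Cor 3.6 p. 408 («constants independent
# of □»), (3.88) p. 409; [B6] = [Balaban1984PropagatorsII] (2.46) p. 231: ★★★ **THE DECAYING INTERIOR `H²` ESTIMATE FOR THE SANDWICH `M_hG′_□(U)M_h`, BLOCK `t` TO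
# BLOCK `s`, ON THE (3.35) CLASS** — for `Φ` carried by `Δ(t)` and `d(t,s) > r₀ + 1`, `Σ_{z∈Δ(s)}Σ_{μν}HS((∇_μ∇_νM_hG′_□M_hΦ)(z)) ≤ C·e^{−2δ₀(d(t,s)−r₀−3)∕(2L)}‖Φ‖²`
# with `C` free of `M` (file 31b of width seat `pub-ymgap-dag-n06-w1`'s set; the analytic half of (β′), dag-n06-w7's design note, pub-ymgap bus 2026-08-28)

statement-level skeleton of published theorems with citation tags; proofs where landed; nothing here is a claim about the Yang–Mills mass gap

WHY ∕ ROUTE (β′).  File 28 proved the GLOBAL estimate (`C_H`); the walk needs the DECAYING one (dag-n06-w7's shape note: `M_h` is unbounded over the family).  With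
`w = M_hG′_□M_hΦ` (`Φ` on `Δ(t)`) and a bump `χ` flat on the stencil of `Δ(s)`, supported in `B(s, r)`, smooth at the block scale (file 30), the Hessians of `w`
and `v := χw` agree on `Δ(s)`; file 27's Bochner–Weitzenböck inequality for `v` has inputs `Δ_Uv = −M_χK(h)u − K(χ)w − (averaging of v)` (`χh²Φ = 0`: `χ`
vanishes on `Δ(t)`), `‖∇v‖`, `‖v‖`, curvature windows — all sums over `B(s, r+2)` of `HS(u)`, `HS(∇u)` (`u = G′_□M_hΦ`): file 31a's decaying budgets.

WHAT IS PROVED (sorry-free; 0 `def`; `r₀ = (d+1)(4(ℓ+1)+1)`; hypotheses as file 28: `(bg9K (M_N ℂ) G i).Reg335 c α₀` with `G ≤ U(N)`, `N ≥ 1`, `0 ≤ cMα₀`,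
`cMα₀(d+1) ≤ 1∕16`; any `D`, real `h` supported in `D` with `|h| ≤ 1`, `|∂h| ≤ κ`, `|∂∂h| ≤ κ₂`, block oscillation `≤ κ_b`; levels in `[j′_D, j_D]` on `D`;
pointwise plaquette window `0 ≤ ε`, `ε ≤ ε_D` within two forward steps of `D`).
* (budgets and localized pieces: file 31a `B9Thm31SiteGsqHessianDecayBudgetsReg335Y`);
* ★★ `hessian_block_far_le_sums` (the Bochner step against the two restricted budgets), ★★★ `hessian_block_far_le`: the displayed estimate with an explicit polynomial constant in `κ, κ₂, κ_b, ε_D, L^{j_D}, L^{−j′_D}, L^{−lev s}`.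
NOT HERE (file 32): the near pairs (file 28's `C_H`), the block duality to `M_hG′_□M_h∇*_ν∇*_μ`, the instantiation `h = hTY`, `D = □̃(c)`.  NON-VACUITY (A6): `U = 1`,
`ε = 0`, `h = 0` inhabit the hypotheses.  HONEST SCOPE: one composition of landed `L²` estimates with the lattice Bochner identity; NOT a node discharge, NOT summit
progress; count-neutral; nothing continuum ∕ OS ∕ mass gap ∕ Clay; the YM mass gap (Clay) is NOT proved by any of this — R4 closes the conditional finite-𝕋⁴ rung
`BalabanLadder.UV` only.  NEW file importing file 31a.  Net new unproved facts: 0.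
-/

noncomputable section

namespace Literature.MathematicalPhysics.QuantumFieldTheory.Balaban1983to89.B9Thm31SiteGsqHessianDecayReg335Y

open Literature.MathematicalPhysics.QuantumFieldTheory.Balaban1983to89
open Node00 B6KLevelCensusIndexV1 B6MultiLevelTorusOperator B6GlobalChartV1 B9BackgroundsKLevelV1
  B9Eq39Adjoint B9Thm311ReadingCoords B9Thm311DeltaPrimePos B9Ineq369CurvatureSmallAtLettersY B9Thm31SiteCoerciveGaugeBlockY B9Thm31SiteGpBoundsReg335Y
  B9Thm31SiteCurvatureCommutatorsY B9Thm31SiteBochnerY B9Thm31SiteGsqHessianReg335Y B9Thm31SiteBlockBumpY B9Thm31SiteGsqHessianDecayBudgetsReg335Y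
open Literature.MathematicalPhysics.QuantumFieldTheory.Balaban1983to89.B9Ineq349SiteAdjoint (trIP_comm trIP_cdS_left)
open Literature.MathematicalPhysics.QuantumFieldTheory.Balaban1983to89.B9Thm37CubeCoverCommutators (cutMulY cutMulY_apply KhY KhY_def cutCommY_apply)
open Literature.MathematicalPhysics.QuantumFieldTheory.Balaban1983to89.B9Thm37CubeCoverCommutatorSizes (avgCoeffY_nonneg)
open Literature.MathematicalPhysics.QuantumFieldTheory.Balaban1983to89.B9Thm311DeltaPrimeSymm (avgCoeffY_eq_ite avgCoeffY_symm)
open Literature.MathematicalPhysics.QuantumFieldTheory.Balaban1983to89.B9Ineq346SecondOrderTorusCutoff (cutoffT)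
open B6Geom246MultiLevelBox B6Geom246MultiLevelTorus B9Thm31SiteCoerciveReg335Y B9Thm31SitePolarisedFormY B9Thm31SiteGsqDecayReg335Y B9Thm31SiteGsqGradDecayReg335Y
  B9Thm31SiteGsqCutoffMixedReg335Y B9Thm31SiteGsqCutoffFactorsReg335Y B9Thm31SiteGsqRecordCutoffReg335Y B9Thm31SiteGsqBlockDistReg335Y B9Thm31SiteAgmonExponentY
  B6AgmonExponentMultiLevelTorus Node00.OpsYLocalInverse
open scoped Matrix Matrix.Norms.L2Operator

variable {d ℓ : ℕ} {hd : 1 ≤ d + 1} {hL : Odd (ℓ + 1) ∧ 1 < ℓ + 1} {b₀ b₁ : ℝ}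
variable (i : KIdx d ℓ hd hL b₀ b₁) {N : ℕ} {G : Subgroup (Matrix (Fin N) (Fin N) ℂ)ˣ}

/-! ## §3 The decaying interior `H²` estimate for far pairs -/

section Far

variable [Nonempty (Fin N)] {c α₀ : ℝ}

set_option maxHeartbeats 400000 in
omit [Nonempty (Fin N)] in
/-- ★★ **THE FAR-PAIR HESSIAN ON `Δ(s)` AGAINST THE TWO RESTRICTED BUDGETS** `S₀ = Σ_{B(s,r+2)}HS(u)`, `S₁ = Σ_{B(s,r+2)}Σ_μHS(∇_μu)` (`u = G′_□M_hΦ`): the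
Bochner–Weitzenböck step of (β′) under the hypotheses of `hessian_block_far_le` below (file 27's `bochner_le` for `v = M_χM_hu`, Hessians equal on `Δ(s)`, route
equation `Δ_Uv = −M_χK(h)u − K(χ)M_hu − avg v`, file 31a's localized pieces).
[cite: Balaban1985BackgroundPropagators, (3.46) p.398 (sixth member), Cor 3.6 p.408, (3.88) p.409, (3.24) p.394; Balaban1984PropagatorsII, (2.46) p.231, p.247] -/
theorem hessian_block_far_le_sums (hG : G ≤ B7Prop2Explicit.unitaryUnits (Matrix (Fin N) (Fin N) ℂ)) {U : CfgY (Matrix (Fin N) (Fin N) ℂ) i}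
    (hU : ∀ μ x, U μ x ∈ G) (D : Finset (SiteY i)) {h : SiteY i → ℝ} {κ κ₂ κb : ℝ} (hh1 : ∀ z, |h z| ≤ 1) (hhκ : ∀ μ z, |h (shiftY i μ z) - h z| ≤ κ)
    (hhκ₂ : ∀ μ z, |h (shiftY i μ z) + h ((shiftY i μ).symm z) - 2 * h z| ≤ κ₂)
    (hhb : ∀ z w : SiteY i, blkOf i.D.toDomains w = blkOf i.D.toDomains z → |h z - h w| ≤ κb) (hhD : ∀ z, z ∉ D → h z = 0)
    {jD' : ℕ} (hjD' : ∀ z ∈ D, jD' ≤ (blkOf i.D.toDomains z).1.1)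
    {ε : SiteY i → ℝ} {εD : ℝ} (hε0 : ∀ z, 0 ≤ ε z) (hεD0 : 0 ≤ εD)
    (hF : ∀ μ ν z, ‖((plaqU (shiftY i) (UboxY i U) μ ν z : (Matrix (Fin N) (Fin N) ℂ)ˣ) : Matrix (Fin N) (Fin N) ℂ) - 1‖ ≤ ε z)
    (hεD : ∀ x μ ν, shiftY i ν (shiftY i μ x) ∈ D → ε x ≤ εD) (hεD' : ∀ x μ, shiftY i μ x ∈ D → ε x ≤ εD)
    (s t : BlkY i) (χ : SiteY i → ℝ) {κχ κχ₂ κχb : ℝ} {r : ℕ} (hχ1 : ∀ z, |χ z| ≤ 1) (hχκ : ∀ μ z, |χ (shiftY i μ z) - χ z| ≤ κχ)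
    (hχκ₂ : ∀ μ z, |χ (shiftY i μ z) + χ ((shiftY i μ).symm z) - 2 * χ z| ≤ κχ₂)
    (hχb : ∀ z w : SiteY i, blkOf i.D.toDomains w = blkOf i.D.toDomains z → |χ z - χ w| ≤ κχb)
    (hχ0 : ∀ z, r < (bondT i.D).dist (blkOf i.D.toDomains z) s → χ z = 0)
    (hpl : ∀ z, blkOf i.D.toDomains z = s → ∀ μ ν : Fin (d + 1), χ z = 1 ∧ χ (shiftY i μ z) = 1 ∧ χ (shiftY i ν (shiftY i μ z)) = 1)
    (hfar : r + 1 ≤ (bondT i.D).dist t s)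
    {Φ : SiteY i → Matrix (Fin N) (Fin N) ℂ} (hΦ : ∀ z, blkOf i.D.toDomains z ≠ t → Φ z = 0) :
    ∑ z ∈ Finset.univ.filter (fun z : SiteY i => blkOf i.D.toDomains z = s), ∑ μ : Fin (d + 1), ∑ ν : Fin (d + 1), ∑ a, ∑ b,
        ‖cdS i U μ (cdS i U ν (cutMulY h (GsqY i (parSymY i) D U (cutMulY h Φ)))) z a b‖ ^ 2
      ≤ 4 / 3 * (4 * (8 * ((d : ℝ) + 1) * κ ^ 2 * (2 * (∑ z ∈ Finset.univ.filter (fun z : SiteY i => (bondT i.D).dist (blkOf i.D.toDomains z) s ≤ r + 2), ∑ μ : Fin (d + 1), ∑ a, ∑ b,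
            ‖cdS i U μ (GsqY i (parSymY i) D U (cutMulY h Φ)) z a b‖ ^ 2)) + 4 * (((d : ℝ) + 1) * κ₂) ^ 2 * (∑ z ∈ Finset.univ.filter (fun z : SiteY i => (bondT i.D).dist (blkOf i.D.toDomains z) s ≤ r + 2), ∑ a, ∑ b,
            ‖GsqY i (parSymY i) D U (cutMulY h Φ) z a b‖ ^ 2) + 2 * κb ^ 2 * ((((((ℓ + 1) ^ jD' : ℕ) : ℝ)) ^ 2)⁻¹ ^ 2 * (∑ z ∈ Finset.univ.filter (fun z : SiteY i => (bondT i.D).dist (blkOf i.D.toDomains z) s ≤ r + 2), ∑ a, ∑ b,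
            ‖GsqY i (parSymY i) D U (cutMulY h Φ) z a b‖ ^ 2)))
        + 4 * (8 * ((d : ℝ) + 1) * κχ ^ 2 * (2 * (2 * (∑ z ∈ Finset.univ.filter (fun z : SiteY i => (bondT i.D).dist (blkOf i.D.toDomains z) s ≤ r + 2), ∑ μ : Fin (d + 1), ∑ a, ∑ b,
            ‖cdS i U μ (GsqY i (parSymY i) D U (cutMulY h Φ)) z a b‖ ^ 2) + 2 * ((d : ℝ) + 1) * κ ^ 2 * (∑ z ∈ Finset.univ.filter (fun z : SiteY i => (bondT i.D).dist (blkOf i.D.toDomains z) s ≤ r + 2), ∑ a, ∑ b,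
            ‖GsqY i (parSymY i) D U (cutMulY h Φ) z a b‖ ^ 2))) + 4 * (((d : ℝ) + 1) * κχ₂) ^ 2 * (∑ z ∈ Finset.univ.filter (fun z : SiteY i => (bondT i.D).dist (blkOf i.D.toDomains z) s ≤ r + 2), ∑ a, ∑ b,
            ‖GsqY i (parSymY i) D U (cutMulY h Φ) z a b‖ ^ 2) + 2 * κχb ^ 2 * ((((((ℓ + 1) ^ jD' : ℕ) : ℝ)) ^ 2)⁻¹ ^ 2 * (∑ z ∈ Finset.univ.filter (fun z : SiteY i => (bondT i.D).dist (blkOf i.D.toDomains z) s ≤ r + 2), ∑ a, ∑ b,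
            ‖GsqY i (parSymY i) D U (cutMulY h Φ) z a b‖ ^ 2)))
        + 2 * ((((((ℓ + 1) ^ jD' : ℕ) : ℝ)) ^ 2)⁻¹ ^ 2 * (∑ z ∈ Finset.univ.filter (fun z : SiteY i => (bondT i.D).dist (blkOf i.D.toDomains z) s ≤ r + 2), ∑ a, ∑ b,
            ‖GsqY i (parSymY i) D U (cutMulY h Φ) z a b‖ ^ 2))
        + (((d : ℝ) + 1) ^ 2 * (4 * (εD ^ 2 * (∑ z ∈ Finset.univ.filter (fun z : SiteY i => (bondT i.D).dist (blkOf i.D.toDomains z) s ≤ r + 2), ∑ a, ∑ b,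
            ‖GsqY i (parSymY i) D U (cutMulY h Φ) z a b‖ ^ 2)))
          + 2 * ((d : ℝ) + 1) * εD * (2 * (2 * (∑ z ∈ Finset.univ.filter (fun z : SiteY i => (bondT i.D).dist (blkOf i.D.toDomains z) s ≤ r + 2), ∑ μ : Fin (d + 1), ∑ a, ∑ b,
            ‖cdS i U μ (GsqY i (parSymY i) D U (cutMulY h Φ)) z a b‖ ^ 2) + 2 * ((d : ℝ) + 1) * κ ^ 2 * (∑ z ∈ Finset.univ.filter (fun z : SiteY i => (bondT i.D).dist (blkOf i.D.toDomains z) s ≤ r + 2), ∑ a, ∑ b,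
            ‖GsqY i (parSymY i) D U (cutMulY h Φ) z a b‖ ^ 2)) + 2 * ((d : ℝ) + 1) * κχ ^ 2 * (∑ z ∈ Finset.univ.filter (fun z : SiteY i => (bondT i.D).dist (blkOf i.D.toDomains z) s ≤ r + 2), ∑ a, ∑ b,
            ‖GsqY i (parSymY i) D U (cutMulY h Φ) z a b‖ ^ 2)))) := by
  classical
  set Ψ' := cutMulY h Φ with hΨ'
  set u := GsqY i (parSymY i) D U Ψ' with hu
  set w := cutMulY h u with hw
  set v := cutMulY χ w with hv
  set mD := (((((ℓ + 1) ^ jD' : ℕ) : ℝ)) ^ 2)⁻¹ with hmD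
  set A0 := Finset.univ.filter (fun z : SiteY i => (bondT i.D).dist (blkOf i.D.toDomains z) s ≤ r) with hA0
  set A1 := Finset.univ.filter (fun z : SiteY i => (bondT i.D).dist (blkOf i.D.toDomains z) s ≤ r + 1) with hA1
  set A2 := Finset.univ.filter (fun z : SiteY i => (bondT i.D).dist (blkOf i.D.toDomains z) s ≤ r + 2) with hA2
  have h02 : A0 ⊆ A2 := filter_distT_subset i s (by omega)
  have h12 : A1 ⊆ A2 := filter_distT_subset i s (by omega)
  have h01 : A0 ⊆ A1 := filter_distT_subset i s (by omega)
  have hκ0 : 0 ≤ κ := le_trans (abs_nonneg _) (hhκ 0 (Classical.arbitrary _))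
  have hκχ0 : 0 ≤ κχ := le_trans (abs_nonneg _) (hχκ 0 (Classical.arbitrary _))
  have hΨ'D : ∀ z, z ∉ D → Ψ' z = 0 := fun z hz => by rw [hΨ', cutMulY_apply, hhD z hz]; simp
  have huD : ∀ z, z ∉ D → u z = 0 := fun z hz => GsqY_apply_eq_zero i (parSymY i) U Ψ' hz
  have hwD : ∀ z, z ∉ D → w z = 0 := fun z hz => by rw [hw, cutMulY_apply, huD z hz, smul_zero]
  have hvD : ∀ z, z ∉ D → v z = 0 := fun z hz => by rw [hv, cutMulY_apply, hwD z hz, smul_zero]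
  set S0 := ∑ z ∈ A2, ∑ a, ∑ b, ‖u z a b‖ ^ 2 with hS0
  set S1 := ∑ z ∈ A2, ∑ μ : Fin (d + 1), ∑ a, ∑ b, ‖cdS i U μ u z a b‖ ^ 2 with hS1
  have hS00 : 0 ≤ S0 := Finset.sum_nonneg fun _ _ => hs_nonneg _
  have hS10 : 0 ≤ S1 := Finset.sum_nonneg fun _ _ => Finset.sum_nonneg fun _ _ => hs_nonneg _
  have hu_ball : ∀ {A : Finset (SiteY i)}, A ⊆ A2 → ∑ z ∈ A, ∑ a, ∑ b, ‖u z a b‖ ^ 2 ≤ S0 := fun hA =>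
    Finset.sum_le_sum_of_subset_of_nonneg hA fun _ _ _ => hs_nonneg _
  have hDu_ball : ∀ {A : Finset (SiteY i)}, A ⊆ A2 → ∑ z ∈ A, ∑ μ : Fin (d + 1), ∑ a, ∑ b, ‖cdS i U μ u z a b‖ ^ 2 ≤ S1 := fun hA =>
    Finset.sum_le_sum_of_subset_of_nonneg hA fun _ _ _ => Finset.sum_nonneg fun _ _ => hs_nonneg _
  have hDsu : ∑ z ∈ A0, ∑ μ : Fin (d + 1), ∑ a, ∑ b, ‖cdsS i U μ u z a b‖ ^ 2 ≤ S1 := by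
    rw [Finset.sum_comm]
    refine (Finset.sum_le_sum fun μ _ => hs_ball_cdsS_le_succ i hG hU s r μ u).trans ?_
    rw [Finset.sum_comm]; exact hDu_ball h12
  have hw_ball : ∀ {A : Finset (SiteY i)}, A ⊆ A2 → ∑ z ∈ A, ∑ a, ∑ b, ‖w z a b‖ ^ 2 ≤ S0 := fun hA =>
    (Finset.sum_le_sum fun z _ => hs_cutMulY_apply_le i hh1 u z).trans (hu_ball hA)
  have hDw_ball : ∀ {A : Finset (SiteY i)}, A ⊆ A2 →
      ∑ z ∈ A, ∑ μ : Fin (d + 1), ∑ a, ∑ b, ‖cdS i U μ w z a b‖ ^ 2 ≤ 2 * S1 + 2 * ((d : ℝ) + 1) * κ ^ 2 * S0 := by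
    intro A hA
    have hpt : ∀ z, ∑ μ : Fin (d + 1), ∑ a, ∑ b, ‖cdS i U μ w z a b‖ ^ 2
        ≤ 2 * ∑ μ : Fin (d + 1), ∑ a, ∑ b, ‖cdS i U μ u z a b‖ ^ 2 + 2 * ((d : ℝ) + 1) * κ ^ 2 * ∑ a, ∑ b, ‖u z a b‖ ^ 2 := by
      intro z
      refine (Finset.sum_le_sum fun μ _ => hs_cdS_cutMulY_le i U μ hh1 hhκ u z).trans (le_of_eq ?_)
      rw [Finset.sum_add_distrib, ← Finset.mul_sum, Finset.sum_const, Finset.card_univ, Fintype.card_fin, nsmul_eq_mul]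
      push_cast; ring
    refine (Finset.sum_le_sum fun z _ => hpt z).trans ?_
    rw [Finset.sum_add_distrib, ← Finset.mul_sum, ← Finset.mul_sum]
    have h1 := hDu_ball hA
    have h2 := hu_ball hA
    have h3 : 0 ≤ 2 * ((d : ℝ) + 1) * κ ^ 2 := by positivity
    nlinarith [mul_le_mul_of_nonneg_left h2 h3]
  have hDsw : ∑ z ∈ A1, ∑ μ : Fin (d + 1), ∑ a, ∑ b, ‖cdsS i U μ w z a b‖ ^ 2 ≤ 2 * S1 + 2 * ((d : ℝ) + 1) * κ ^ 2 * S0 := by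
    rw [Finset.sum_comm]
    refine (Finset.sum_le_sum fun μ _ => hs_ball_cdsS_le_succ i hG hU s (r + 1) μ w).trans ?_
    rw [Finset.sum_comm]; exact hDw_ball le_rfl
  have hvv : ∑ z, ∑ a, ∑ b, ‖v z a b‖ ^ 2 ≤ S0 := (sum_hs_cutMulY_bump_le i s χ hχ1 hχ0 w).trans (hw_ball h02)
  have hDv : ∀ μ : Fin (d + 1), ∑ z, ∑ a, ∑ b, ‖cdS i U μ v z a b‖ ^ 2
      ≤ 2 * ∑ z ∈ A1, ∑ a, ∑ b, ‖cdS i U μ w z a b‖ ^ 2 + 2 * κχ ^ 2 * ∑ z ∈ A1, ∑ a, ∑ b, ‖w z a b‖ ^ 2 := fun μ =>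
    sum_hs_cdS_cutMulY_bump_le i s χ U μ hχ1 hχκ hχ0 w
  have hDvsum : ∑ μ : Fin (d + 1), ∑ z, ∑ a, ∑ b, ‖cdS i U μ v z a b‖ ^ 2
      ≤ 2 * (2 * S1 + 2 * ((d : ℝ) + 1) * κ ^ 2 * S0) + 2 * ((d : ℝ) + 1) * κχ ^ 2 * S0 := by
    refine (Finset.sum_le_sum fun μ _ => hDv μ).trans ?_
    rw [Finset.sum_add_distrib, ← Finset.mul_sum, Finset.sum_const, Finset.card_univ, Fintype.card_fin, nsmul_eq_mul, Finset.sum_comm]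
    push_cast
    have h1 := hDw_ball (A := A1) h12
    have h2 := hw_ball (A := A1) h12
    have h3 : 0 ≤ ((d : ℝ) + 1) * (2 * κχ ^ 2) := by positivity
    nlinarith [mul_le_mul_of_nonneg_left h2 h3]
  have hP1 : ∑ z, ∑ a, ∑ b, ‖cutMulY χ (KhY i (parSymY i) h U u) z a b‖ ^ 2
      ≤ 8 * ((d : ℝ) + 1) * κ ^ 2 * (2 * S1) + 4 * (((d : ℝ) + 1) * κ₂) ^ 2 * S0 + 2 * κb ^ 2 * (mD ^ 2 * S0) := by
    refine (sum_hs_cutMulY_bump_KhY_le i s χ hG hU hχ1 hχ0 hhκ hhκ₂ hhb u).trans ?_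
    have g1 : ∑ z ∈ A0, ∑ μ : Fin (d + 1), (∑ a, ∑ b, ‖cdS i U μ u z a b‖ ^ 2 + ∑ a, ∑ b, ‖cdsS i U μ u z a b‖ ^ 2) ≤ 2 * S1 := by
      simp only [Finset.sum_add_distrib]
      have := hDu_ball h02
      linarith [hDsu]
    have g2 := (sum_levelMass_avg_ball_le i huD hjD' s r).trans (mul_le_mul_of_nonneg_left (hu_ball h02) (by positivity))
    have g3 := hu_ball h02
    have hκb2 : 0 ≤ 2 * κb ^ 2 := by positivity
    have hk2 : 0 ≤ 4 * (((d : ℝ) + 1) * κ₂) ^ 2 := by positivity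
    have hk1 : 0 ≤ 8 * ((d : ℝ) + 1) * κ ^ 2 := by positivity
    exact add_le_add (add_le_add (mul_le_mul_of_nonneg_left g1 hk1) (mul_le_mul_of_nonneg_left g3 hk2)) (mul_le_mul_of_nonneg_left g2 hκb2)
  have hP2 : ∑ z, ∑ a, ∑ b, ‖KhY i (parSymY i) χ U w z a b‖ ^ 2
      ≤ 8 * ((d : ℝ) + 1) * κχ ^ 2 * (2 * (2 * S1 + 2 * ((d : ℝ) + 1) * κ ^ 2 * S0)) + 4 * (((d : ℝ) + 1) * κχ₂) ^ 2 * S0 + 2 * κχb ^ 2 * (mD ^ 2 * S0) := by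
    refine (sum_hs_KhY_bump_le i s χ hG hU hχκ hχκ₂ hχb hχ0 w).trans ?_
    have g1 : ∑ z ∈ A1, ∑ μ : Fin (d + 1), (∑ a, ∑ b, ‖cdS i U μ w z a b‖ ^ 2 + ∑ a, ∑ b, ‖cdsS i U μ w z a b‖ ^ 2)
        ≤ 2 * (2 * S1 + 2 * ((d : ℝ) + 1) * κ ^ 2 * S0) := by
      simp only [Finset.sum_add_distrib]
      have := hDw_ball (A := A1) h12
      linarith [hDsw]
    have g2 := (sum_levelMass_avg_ball_le i hwD hjD' s (r + 1)).trans (mul_le_mul_of_nonneg_left (hw_ball (A := A1) h12) (by positivity))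
    have g3 := hw_ball (A := A1) h12
    have hκb2 : 0 ≤ 2 * κχb ^ 2 := by positivity
    have hk2 : 0 ≤ 4 * (((d : ℝ) + 1) * κχ₂) ^ 2 := by positivity
    have hk1 : 0 ≤ 8 * ((d : ℝ) + 1) * κχ ^ 2 := by positivity
    exact add_le_add (add_le_add (mul_le_mul_of_nonneg_left g1 hk1) (mul_le_mul_of_nonneg_left g3 hk2)) (mul_le_mul_of_nonneg_left g2 hκb2)
  -- (L) the route equation: `Δ_U v = −M_χK(h)u − K(χ)w − (averaging of v)`
  have hlap : ∀ z, lapS i U v z = -(cutMulY χ (KhY i (parSymY i) h U u) z + KhY i (parSymY i) χ U w z)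
      - ∑ w', ((avgCoeffY i z w' : ℝ) : ℂ) • R (avgTrY i (parSymY i) U z w') (v w') := by
    intro z
    have e1 : deltaPrimeAY i (parSymY i) U v z = lapS i U v z + ∑ w', ((avgCoeffY i z w' : ℝ) : ℂ) • R (avgTrY i (parSymY i) U z w') (v w') :=
      deltaPrimeAY_apply i (parSymY i) U v z
    have e2 : KhY i (parSymY i) h U u z = ((h z : ℝ) : ℂ) • deltaPrimeAY i (parSymY i) U u z - deltaPrimeAY i (parSymY i) U w z := by
      rw [KhY_def, cutCommY_apply]
    have e2' : KhY i (parSymY i) χ U w z = ((χ z : ℝ) : ℂ) • deltaPrimeAY i (parSymY i) U w z - deltaPrimeAY i (parSymY i) U v z := by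
      rw [KhY_def, cutCommY_apply]
    have e3 : ((h z : ℝ) : ℂ) • deltaPrimeAY i (parSymY i) U u z = cutMulY h Ψ' z := by
      by_cases hz : z ∈ D
      · have hc := congrFun (cubeProjY_deltaPrimeAY_GsqY_apply i hG hU D Ψ') z
        rw [cubeProjY_apply, cubeProjY_apply, if_pos hz, if_pos hz] at hc
        rw [hc, cutMulY_apply]
      · rw [hhD z hz, cutMulY_apply, hhD z hz]; simp
    have e4 : ((χ z : ℝ) : ℂ) • cutMulY h Ψ' z = 0 := by
      by_cases hzt : blkOf i.D.toDomains z = t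
      · rw [hχ0 z (by rw [hzt]; omega)]; simp
      · rw [cutMulY_apply, hΨ', cutMulY_apply, hΦ z hzt]; simp
    have e5 : deltaPrimeAY i (parSymY i) U v z = -(cutMulY χ (KhY i (parSymY i) h U u) z + KhY i (parSymY i) χ U w z) := by
      have e6 : deltaPrimeAY i (parSymY i) U v z = ((χ z : ℝ) : ℂ) • deltaPrimeAY i (parSymY i) U w z - KhY i (parSymY i) χ U w z := by
        rw [e2']; abel
      have e7 : deltaPrimeAY i (parSymY i) U w z = cutMulY h Ψ' z - KhY i (parSymY i) h U u z := by rw [e2, e3]; abel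
      rw [e6, e7, smul_sub, e4, cutMulY_apply, zero_sub]
      abel
    calc lapS i U v z = deltaPrimeAY i (parSymY i) U v z - ∑ w', ((avgCoeffY i z w' : ℝ) : ℂ) • R (avgTrY i (parSymY i) U z w') (v w') := by
          rw [e1, add_sub_cancel_right]
      _ = _ := by rw [e5]
  have hlapHS : ∑ z, ∑ a, ∑ b, ‖lapS i U v z a b‖ ^ 2
      ≤ 4 * (8 * ((d : ℝ) + 1) * κ ^ 2 * (2 * S1) + 4 * (((d : ℝ) + 1) * κ₂) ^ 2 * S0 + 2 * κb ^ 2 * (mD ^ 2 * S0))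
        + 4 * (8 * ((d : ℝ) + 1) * κχ ^ 2 * (2 * (2 * S1 + 2 * ((d : ℝ) + 1) * κ ^ 2 * S0)) + 4 * (((d : ℝ) + 1) * κχ₂) ^ 2 * S0 + 2 * κχb ^ 2 * (mD ^ 2 * S0))
        + 2 * (mD ^ 2 * S0) := by
    have hmem : ∀ z w', avgTrY i (parSymY i) U z w' ∈ G := fun z w' => G.mul_mem (parSymY_mem i hU _ _) (parSymY_mem i hU _ _)
    have hpt : ∀ z, ∑ a, ∑ b, ‖lapS i U v z a b‖ ^ 2
        ≤ 4 * ∑ a, ∑ b, ‖cutMulY χ (KhY i (parSymY i) h U u) z a b‖ ^ 2 + 4 * ∑ a, ∑ b, ‖KhY i (parSymY i) χ U w z a b‖ ^ 2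
          + 2 * ((((((ℓ + 1) ^ (blkOf i.D.toDomains z).1.1 : ℕ) : ℝ)) ^ 2)⁻¹ * ∑ w', avgCoeffY i z w' * ∑ a, ∑ b, ‖v w' a b‖ ^ 2) := by
      intro z
      rw [hlap z]
      have h1 := hs_sub_le (-(cutMulY χ (KhY i (parSymY i) h U u) z + KhY i (parSymY i) χ U w z))
        (∑ w', ((avgCoeffY i z w' : ℝ) : ℂ) • R (avgTrY i (parSymY i) U z w') (v w'))
      have h2 := hs_add_le (cutMulY χ (KhY i (parSymY i) h U u) z) (KhY i (parSymY i) χ U w z)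
      have hneg : ∑ a, ∑ b, ‖(-(cutMulY χ (KhY i (parSymY i) h U u) z + KhY i (parSymY i) χ U w z)) a b‖ ^ 2
          = ∑ a, ∑ b, ‖(cutMulY χ (KhY i (parSymY i) h U u) z + KhY i (parSymY i) χ U w z) a b‖ ^ 2 := by
        simp only [Matrix.neg_apply, norm_neg]
      have h4 : ∑ a, ∑ b, ‖(∑ w', ((avgCoeffY i z w' : ℝ) : ℂ) • R (avgTrY i (parSymY i) U z w') (v w')) a b‖ ^ 2
          ≤ (((((ℓ + 1) ^ (blkOf i.D.toDomains z).1.1 : ℕ) : ℝ)) ^ 2)⁻¹ * ∑ w', avgCoeffY i z w' * ∑ a, ∑ b, ‖v w' a b‖ ^ 2 := by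
        have hcs := hs_sum_smul_le_of_abs_le (N := N) (fun w' => avgCoeffY i z w') (fun w' => avgCoeffY i z w')
          (fun w' => by rw [abs_of_nonneg (avgCoeffY_nonneg i z w')]) (fun w' => R (avgTrY i (parSymY i) U z w') (v w'))
        refine hcs.trans ?_
        have hR : ∀ w', ∑ a, ∑ b, ‖R (avgTrY i (parSymY i) U z w') (v w') a b‖ ^ 2 ≤ ∑ a, ∑ b, ‖v w' a b‖ ^ 2 := fun w' =>
          hs_R_le (contractive_of_mem_unitary (V := avgTrY i (parSymY i) U z w') (hG (hmem z w'))) (v w')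
        refine mul_le_mul (sum_avgCoeffY_le i z) (Finset.sum_le_sum fun w' _ => mul_le_mul_of_nonneg_left (hR w') (avgCoeffY_nonneg i z w'))
          (Finset.sum_nonneg fun w' _ => mul_nonneg (avgCoeffY_nonneg i z w') (hs_nonneg _)) (by positivity)
      rw [hneg] at h1
      linarith
    refine (Finset.sum_le_sum fun z (_ : z ∈ Finset.univ) => hpt z).trans ?_
    rw [Finset.sum_add_distrib, Finset.sum_add_distrib, ← Finset.mul_sum, ← Finset.mul_sum, ← Finset.mul_sum]
    have a3 := (sum_levelMass_avg_le i hvD hjD').trans (mul_le_mul_of_nonneg_left hvv (by positivity))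
    exact add_le_add (add_le_add (mul_le_mul_of_nonneg_left hP1 (by norm_num : (0 : ℝ) ≤ 4)) (mul_le_mul_of_nonneg_left hP2 (by norm_num : (0 : ℝ) ≤ 4)))
      (mul_le_mul_of_nonneg_left a3 (by norm_num : (0 : ℝ) ≤ 2))
  have hcdS_ne : ∀ (μ : Fin (d + 1)) (Λ : SiteY i → Matrix (Fin N) (Fin N) ℂ) (y : SiteY i),
      cdS i U μ Λ y ≠ 0 → Λ y ≠ 0 ∨ Λ (shiftY i μ y) ≠ 0 := by
    intro μ Λ y hne
    by_contra hcon
    simp only [not_or, not_not] at hcon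
    apply hne
    show R (UboxY i U μ y) (Λ (shiftY i μ y)) - Λ y = 0
    rw [hcon.1, hcon.2, R_zero, sub_zero]
  have hvD' : ∀ y, v y ≠ 0 → y ∈ D := fun y hy => by by_contra hy'; exact hy (hvD y hy')
  have T1 : ∀ μ ν : Fin (d + 1), ∑ z, ε z ^ 2 * ∑ a, ∑ b, ‖v (shiftY i ν (shiftY i μ z)) a b‖ ^ 2 ≤ εD ^ 2 * S0 := by
    intro μ ν
    have hpt : ∀ z, ε z ^ 2 * ∑ a, ∑ b, ‖v (shiftY i ν (shiftY i μ z)) a b‖ ^ 2 ≤ εD ^ 2 * ∑ a, ∑ b, ‖v (shiftY i ν (shiftY i μ z)) a b‖ ^ 2 := by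
      intro z
      by_cases hz : v (shiftY i ν (shiftY i μ z)) = 0
      · rw [hz]; simp
      · have hε := hεD z μ ν (hvD' _ hz)
        exact mul_le_mul_of_nonneg_right (pow_le_pow_left₀ (hε0 z) hε 2) (hs_nonneg _)
    refine (Finset.sum_le_sum fun z _ => hpt z).trans ?_
    rw [← Finset.mul_sum, Fintype.sum_equiv ((shiftY i μ).trans (shiftY i ν)) (fun z => ∑ a, ∑ b, ‖v (shiftY i ν (shiftY i μ z)) a b‖ ^ 2)
      (fun z => ∑ a, ∑ b, ‖v z a b‖ ^ 2) fun z => rfl]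
    exact mul_le_mul_of_nonneg_left hvv (by positivity)
  have hεgrad : ∀ (x : SiteY i) (μ ν : Fin (d + 1)), cdS i U ν v (shiftY i μ x) ≠ 0 → ε x ≤ εD := by
    intro x μ ν hne
    rcases hcdS_ne ν v _ hne with h1 | h1
    · exact hεD' x μ (hvD' _ h1)
    · exact hεD x μ ν (hvD' _ h1)
  have T2 : ∀ μ ν : Fin (d + 1),
      ∑ z, ε ((shiftY i ν).symm z) * (∑ a, ∑ b, ‖cdS i U ν v (shiftY i μ ((shiftY i ν).symm z)) a b‖ ^ 2 + ∑ a, ∑ b, ‖cdS i U μ v z a b‖ ^ 2)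
        ≤ εD * (∑ z, ∑ a, ∑ b, ‖cdS i U ν v z a b‖ ^ 2 + ∑ z, ∑ a, ∑ b, ‖cdS i U μ v z a b‖ ^ 2) := by
    intro μ ν
    rw [← Fintype.sum_equiv (shiftY i ν) (fun x => ε x * (∑ a, ∑ b, ‖cdS i U ν v (shiftY i μ x) a b‖ ^ 2 + ∑ a, ∑ b, ‖cdS i U μ v (shiftY i ν x) a b‖ ^ 2))
      (fun z => ε ((shiftY i ν).symm z) * (∑ a, ∑ b, ‖cdS i U ν v (shiftY i μ ((shiftY i ν).symm z)) a b‖ ^ 2 + ∑ a, ∑ b, ‖cdS i U μ v z a b‖ ^ 2))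
      (fun x => by simp only [Equiv.symm_apply_apply])]
    have hpt : ∀ x, ε x * (∑ a, ∑ b, ‖cdS i U ν v (shiftY i μ x) a b‖ ^ 2 + ∑ a, ∑ b, ‖cdS i U μ v (shiftY i ν x) a b‖ ^ 2)
        ≤ εD * ∑ a, ∑ b, ‖cdS i U ν v (shiftY i μ x) a b‖ ^ 2 + εD * ∑ a, ∑ b, ‖cdS i U μ v (shiftY i ν x) a b‖ ^ 2 := by
      intro x
      rw [mul_add]
      refine add_le_add ?_ ?_
      · by_cases hz : cdS i U ν v (shiftY i μ x) = 0
        · rw [hz]; simp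
        · exact mul_le_mul_of_nonneg_right (hεgrad x μ ν hz) (hs_nonneg _)
      · by_cases hz : cdS i U μ v (shiftY i ν x) = 0
        · rw [hz]; simp
        · exact mul_le_mul_of_nonneg_right (hεgrad x ν μ hz) (hs_nonneg _)
    refine (Finset.sum_le_sum fun x _ => hpt x).trans (le_of_eq ?_)
    rw [Finset.sum_add_distrib, ← Finset.mul_sum, ← Finset.mul_sum, mul_add,
      Fintype.sum_equiv (shiftY i μ) (fun x => ∑ a, ∑ b, ‖cdS i U ν v (shiftY i μ x) a b‖ ^ 2) (fun z => ∑ a, ∑ b, ‖cdS i U ν v z a b‖ ^ 2) fun x => rfl,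
      Fintype.sum_equiv (shiftY i ν) (fun x => ∑ a, ∑ b, ‖cdS i U μ v (shiftY i ν x) a b‖ ^ 2) (fun z => ∑ a, ∑ b, ‖cdS i U μ v z a b‖ ^ 2) fun x => rfl]
  have hεsum : ∑ μ : Fin (d + 1), ∑ ν : Fin (d + 1),
      (4 * ∑ z, ε z ^ 2 * ∑ a, ∑ b, ‖v (shiftY i ν (shiftY i μ z)) a b‖ ^ 2
        + ∑ z, ε ((shiftY i ν).symm z) * (∑ a, ∑ b, ‖cdS i U ν v (shiftY i μ ((shiftY i ν).symm z)) a b‖ ^ 2 + ∑ a, ∑ b, ‖cdS i U μ v z a b‖ ^ 2))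
      ≤ ((d : ℝ) + 1) ^ 2 * (4 * (εD ^ 2 * S0))
        + 2 * ((d : ℝ) + 1) * εD * (2 * (2 * S1 + 2 * ((d : ℝ) + 1) * κ ^ 2 * S0) + 2 * ((d : ℝ) + 1) * κχ ^ 2 * S0) := by
    have hstep : ∑ μ : Fin (d + 1), ∑ ν : Fin (d + 1),
        (4 * ∑ z, ε z ^ 2 * ∑ a, ∑ b, ‖v (shiftY i ν (shiftY i μ z)) a b‖ ^ 2
          + ∑ z, ε ((shiftY i ν).symm z) * (∑ a, ∑ b, ‖cdS i U ν v (shiftY i μ ((shiftY i ν).symm z)) a b‖ ^ 2 + ∑ a, ∑ b, ‖cdS i U μ v z a b‖ ^ 2))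
        ≤ ∑ μ : Fin (d + 1), ∑ ν : Fin (d + 1), (4 * (εD ^ 2 * S0)
            + εD * ((fun μ' : Fin (d + 1) => ∑ z, ∑ a, ∑ b, ‖cdS i U μ' v z a b‖ ^ 2) ν + (fun μ' : Fin (d + 1) => ∑ z, ∑ a, ∑ b, ‖cdS i U μ' v z a b‖ ^ 2) μ)) :=
      Finset.sum_le_sum fun μ _ => Finset.sum_le_sum fun ν _ => add_le_add (mul_le_mul_of_nonneg_left (T1 μ ν) (by norm_num)) (T2 μ ν)
    refine hstep.trans ?_
    rw [sum_sum_const_add_pair]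
    have h2 : 2 * ((d : ℝ) + 1) * εD * ∑ μ : Fin (d + 1), (fun μ' : Fin (d + 1) => ∑ z, ∑ a, ∑ b, ‖cdS i U μ' v z a b‖ ^ 2) μ
        ≤ 2 * ((d : ℝ) + 1) * εD * (2 * (2 * S1 + 2 * ((d : ℝ) + 1) * κ ^ 2 * S0) + 2 * ((d : ℝ) + 1) * κχ ^ 2 * S0) :=
      mul_le_mul_of_nonneg_left hDvsum (by positivity)
    exact add_le_add le_rfl h2
  -- the Bochner–Weitzenböck inequality for `v`, and the output restricted to `Δ(s)` where the Hessians of `v` and `w` agree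
  have hB := bochner_le i hG hU hF v
  have hlapQ : trIP (fun _ => (1 : ℝ)) (lapS i U v) (lapS i U v)
      ≤ 4 * (8 * ((d : ℝ) + 1) * κ ^ 2 * (2 * S1) + 4 * (((d : ℝ) + 1) * κ₂) ^ 2 * S0 + 2 * κb ^ 2 * (mD ^ 2 * S0))
        + 4 * (8 * ((d : ℝ) + 1) * κχ ^ 2 * (2 * (2 * S1 + 2 * ((d : ℝ) + 1) * κ ^ 2 * S0)) + 4 * (((d : ℝ) + 1) * κχ₂) ^ 2 * S0 + 2 * κχb ^ 2 * (mD ^ 2 * S0))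
        + 2 * (mD ^ 2 * S0) := by rw [trIP_one_self_eq]; exact hlapHS
  have hout : ∑ z ∈ Finset.univ.filter (fun z : SiteY i => blkOf i.D.toDomains z = s), ∑ μ : Fin (d + 1), ∑ ν : Fin (d + 1), ∑ a, ∑ b,
        ‖cdS i U μ (cdS i U ν w) z a b‖ ^ 2
      ≤ ∑ μ : Fin (d + 1), ∑ ν : Fin (d + 1), trIP (fun _ => (1 : ℝ)) (cdS i U μ (cdS i U ν v)) (cdS i U μ (cdS i U ν v)) := by
    have e : ∑ z ∈ Finset.univ.filter (fun z : SiteY i => blkOf i.D.toDomains z = s), ∑ μ : Fin (d + 1), ∑ ν : Fin (d + 1), ∑ a, ∑ b,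
          ‖cdS i U μ (cdS i U ν w) z a b‖ ^ 2
        = ∑ z ∈ Finset.univ.filter (fun z : SiteY i => blkOf i.D.toDomains z = s), ∑ μ : Fin (d + 1), ∑ ν : Fin (d + 1), ∑ a, ∑ b,
          ‖cdS i U μ (cdS i U ν v) z a b‖ ^ 2 := by
      refine Finset.sum_congr rfl fun z hz => ?_
      have hzs : blkOf i.D.toDomains z = s := (Finset.mem_filter.1 hz).2
      refine Finset.sum_congr rfl fun μ _ => Finset.sum_congr rfl fun ν _ => ?_
      rw [hv, cdS_cdS_cutMulY_apply_eq_of_plateau i s U χ hpl μ ν w hzs]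
    rw [e]
    calc ∑ z ∈ Finset.univ.filter (fun z : SiteY i => blkOf i.D.toDomains z = s), ∑ μ : Fin (d + 1), ∑ ν : Fin (d + 1), ∑ a, ∑ b,
          ‖cdS i U μ (cdS i U ν v) z a b‖ ^ 2
        ≤ ∑ z, ∑ μ : Fin (d + 1), ∑ ν : Fin (d + 1), ∑ a, ∑ b, ‖cdS i U μ (cdS i U ν v) z a b‖ ^ 2 :=
          Finset.sum_le_sum_of_subset_of_nonneg (Finset.subset_univ _) fun _ _ _ =>
            Finset.sum_nonneg fun _ _ => Finset.sum_nonneg fun _ _ => hs_nonneg _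
      _ = ∑ μ : Fin (d + 1), ∑ ν : Fin (d + 1), trIP (fun _ => (1 : ℝ)) (cdS i U μ (cdS i U ν v)) (cdS i U μ (cdS i U ν v)) := by
          rw [Finset.sum_comm]
          refine Finset.sum_congr rfl fun μ _ => ?_
          rw [Finset.sum_comm]
          refine Finset.sum_congr rfl fun ν _ => ?_
          rw [trIP_one_self_eq]
  have hfin := add_le_add hlapQ hεsum
  have h43 : (0 : ℝ) ≤ 4 / 3 := by norm_num
  exact hout.trans (hB.trans (mul_le_mul_of_nonneg_left hfin h43))

set_option maxHeartbeats 400000 in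
/-- ★★★ **THE DECAYING INTERIOR `H²` ESTIMATE FOR THE SANDWICH `M_hG′_□(U)M_h`, BLOCK `t` TO BLOCK `s` (FAR PAIRS), ON THE (3.35) CLASS.**  Hypotheses as file 28
plus a real bump `χ` (`|χ| ≤ 1`, `|∂χ| ≤ κ_χ`, `|∂_μ∂_μχ| ≤ κ_χ₂`, block oscillation `≤ κ_χb`, `χ = 0` outside `B(s, r)`, `χ = 1` on the stencil of `Δ(s)`; file 30's
`cutoffT i.D s` qualifies with `2L^{−lev s}`, `2L^{−2lev s}`, `1`, `r₀`) and `d(t, s) ≥ r + 1`: for `Φ` carried by `Δ(t)`,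
`Σ_{z∈Δ(s)}Σ_{μν}HS((∇_μ∇_νM_hG′_□M_hΦ)(z)) ≤ (4∕3)C_far·‖Φ‖²∕E²`, `E = e^{δ₀((d(t,s)−(r+2))−1)∕(2L)}`, `C_far` the displayed polynomial — NO power of `M` (print's (3.46)
sixth member, Cor 3.6 «constants independent of □»).
[cite: Balaban1985BackgroundPropagators, (3.46) p.398 (sixth member), Cor 3.6 p.408, (3.88) p.409, (3.24) p.394, (3.35) p.396; Balaban1984PropagatorsII, (2.43)–(2.44) p.230, (2.46) p.231, p.247; Agmon1982, Ch.1, Thm 1.5] -/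
theorem hessian_block_far_le (hG : G ≤ B7Prop2Explicit.unitaryUnits (Matrix (Fin N) (Fin N) ℂ)) {U : CfgY (Matrix (Fin N) (Fin N) ℂ) i}
    (hC0 : 0 ≤ c * (kGeo i).M * α₀) (hC1 : c * (kGeo i).M * α₀ * ((d : ℝ) + 1) ≤ 1 / 16) (hreg : (bg9K (Matrix (Fin N) (Fin N) ℂ) G i).Reg335 c α₀ U)
    (D : Finset (SiteY i)) {h : SiteY i → ℝ} {κ κ₂ κb : ℝ} (hh1 : ∀ z, |h z| ≤ 1) (hhκ : ∀ μ z, |h (shiftY i μ z) - h z| ≤ κ)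
    (hhκ₂ : ∀ μ z, |h (shiftY i μ z) + h ((shiftY i μ).symm z) - 2 * h z| ≤ κ₂)
    (hhb : ∀ z w : SiteY i, blkOf i.D.toDomains w = blkOf i.D.toDomains z → |h z - h w| ≤ κb) (hhD : ∀ z, z ∉ D → h z = 0)
    {jD jD' : ℕ} (hjD : ∀ z ∈ D, (blkOf i.D.toDomains z).1.1 ≤ jD) (hjD' : ∀ z ∈ D, jD' ≤ (blkOf i.D.toDomains z).1.1)
    {ε : SiteY i → ℝ} {εD : ℝ} (hε0 : ∀ z, 0 ≤ ε z) (hεD0 : 0 ≤ εD)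
    (hF : ∀ μ ν z, ‖((plaqU (shiftY i) (UboxY i U) μ ν z : (Matrix (Fin N) (Fin N) ℂ)ˣ) : Matrix (Fin N) (Fin N) ℂ) - 1‖ ≤ ε z)
    (hεD : ∀ x μ ν, shiftY i ν (shiftY i μ x) ∈ D → ε x ≤ εD) (hεD' : ∀ x μ, shiftY i μ x ∈ D → ε x ≤ εD)
    (s t : BlkY i) (χ : SiteY i → ℝ) {κχ κχ₂ κχb : ℝ} {r : ℕ} (hχ1 : ∀ z, |χ z| ≤ 1) (hχκ : ∀ μ z, |χ (shiftY i μ z) - χ z| ≤ κχ)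
    (hχκ₂ : ∀ μ z, |χ (shiftY i μ z) + χ ((shiftY i μ).symm z) - 2 * χ z| ≤ κχ₂)
    (hχb : ∀ z w : SiteY i, blkOf i.D.toDomains w = blkOf i.D.toDomains z → |χ z - χ w| ≤ κχb)
    (hχ0 : ∀ z, r < (bondT i.D).dist (blkOf i.D.toDomains z) s → χ z = 0)
    (hpl : ∀ z, blkOf i.D.toDomains z = s → ∀ μ ν : Fin (d + 1), χ z = 1 ∧ χ (shiftY i μ z) = 1 ∧ χ (shiftY i ν (shiftY i μ z)) = 1)
    (hfar : r + 1 ≤ (bondT i.D).dist t s)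
    {Φ : SiteY i → Matrix (Fin N) (Fin N) ℂ} (hΦ : ∀ z, blkOf i.D.toDomains z ≠ t → Φ z = 0) :
    ∑ z ∈ Finset.univ.filter (fun z : SiteY i => blkOf i.D.toDomains z = s), ∑ μ : Fin (d + 1), ∑ ν : Fin (d + 1), ∑ a, ∑ b,
        ‖cdS i U μ (cdS i U ν (cutMulY h (GsqY i (parSymY i) D U (cutMulY h Φ)))) z a b‖ ^ 2
      ≤ 4 / 3 * (4 * (8 * ((d : ℝ) + 1) * κ ^ 2 * (2 * (160 * ((((ℓ + 1) ^ jD : ℕ) : ℝ)) ^ 2)) + 4 * (((d : ℝ) + 1) * κ₂) ^ 2 * (256 * (((((ℓ + 1) ^ jD : ℕ) : ℝ)) ^ 2 * ((((ℓ + 1) ^ jD : ℕ) : ℝ)) ^ 2)) + 2 * κb ^ 2 * ((((((ℓ + 1) ^ jD' : ℕ) : ℝ)) ^ 2)⁻¹ ^ 2 * (256 * (((((ℓ + 1) ^ jD : ℕ) : ℝ)) ^ 2 * ((((ℓ + 1) ^ jD : ℕ) : ℝ)) ^ 2))))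
        + 4 * (8 * ((d : ℝ) + 1) * κχ ^ 2 * (2 * (2 * (160 * ((((ℓ + 1) ^ jD : ℕ) : ℝ)) ^ 2) + 2 * ((d : ℝ) + 1) * κ ^ 2 * (256 * (((((ℓ + 1) ^ jD : ℕ) : ℝ)) ^ 2 * ((((ℓ + 1) ^ jD : ℕ) : ℝ)) ^ 2)))) + 4 * (((d : ℝ) + 1) * κχ₂) ^ 2 * (256 * (((((ℓ + 1) ^ jD : ℕ) : ℝ)) ^ 2 * ((((ℓ + 1) ^ jD : ℕ) : ℝ)) ^ 2)) + 2 * κχb ^ 2 * ((((((ℓ + 1) ^ jD' : ℕ) : ℝ)) ^ 2)⁻¹ ^ 2 * (256 * (((((ℓ + 1) ^ jD : ℕ) : ℝ)) ^ 2 * ((((ℓ + 1) ^ jD : ℕ) : ℝ)) ^ 2))))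
        + 2 * ((((((ℓ + 1) ^ jD' : ℕ) : ℝ)) ^ 2)⁻¹ ^ 2 * (256 * (((((ℓ + 1) ^ jD : ℕ) : ℝ)) ^ 2 * ((((ℓ + 1) ^ jD : ℕ) : ℝ)) ^ 2)))
        + (((d : ℝ) + 1) ^ 2 * (4 * (εD ^ 2 * (256 * (((((ℓ + 1) ^ jD : ℕ) : ℝ)) ^ 2 * ((((ℓ + 1) ^ jD : ℕ) : ℝ)) ^ 2))))
          + 2 * ((d : ℝ) + 1) * εD * (2 * (2 * (160 * ((((ℓ + 1) ^ jD : ℕ) : ℝ)) ^ 2) + 2 * ((d : ℝ) + 1) * κ ^ 2 * (256 * (((((ℓ + 1) ^ jD : ℕ) : ℝ)) ^ 2 * ((((ℓ + 1) ^ jD : ℕ) : ℝ)) ^ 2))) + 2 * ((d : ℝ) + 1) * κχ ^ 2 * (256 * (((((ℓ + 1) ^ jD : ℕ) : ℝ)) ^ 2 * ((((ℓ + 1) ^ jD : ℕ) : ℝ)) ^ 2)))))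
          / Real.exp ((1 / (4 * ((d : ℝ) + 2))) * (((((bondT i.D).dist t s - (r + 2) : ℕ) : ℝ) - 1) / (2 * ((ℓ + 1 : ℕ) : ℝ)))) ^ 2 * trIP (fun _ => (1 : ℝ)) Φ Φ := by
  have hA := hessian_block_far_le_sums i hG hreg.1 D hh1 hhκ hhκ₂ hhb hhD hjD' hε0 hεD0 hF hεD hεD' s t χ hχ1 hχκ hχκ₂ hχb hχ0 hpl hfar hΦ
  have hS0b := hs_ball_GsqY_le i hG hC0 hC1 hreg D hh1 hhD hjD s t (r + 2) hΦ
  have hS1b := hs_ball_cdS_GsqY_le i hG hC0 hC1 hreg D hh1 hhD hjD s t (r + 2) hΦ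
  have h43 : (0 : ℝ) ≤ 4 / 3 := by norm_num
  have hmono : 4 / 3 * (4 * (8 * ((d : ℝ) + 1) * κ ^ 2 * (2 * (∑ z ∈ Finset.univ.filter (fun z : SiteY i => (bondT i.D).dist (blkOf i.D.toDomains z) s ≤ r + 2), ∑ μ : Fin (d + 1), ∑ a, ∑ b, ‖cdS i U μ (GsqY i (parSymY i) D U (cutMulY h Φ)) z a b‖ ^ 2)) + 4 * (((d : ℝ) + 1) * κ₂) ^ 2 * (∑ z ∈ Finset.univ.filter (fun z : SiteY i => (bondT i.D).dist (blkOf i.D.toDomains z) s ≤ r + 2), ∑ a, ∑ b, ‖GsqY i (parSymY i) D U (cutMulY h Φ) z a b‖ ^ 2) + 2 * κb ^ 2 * ((((((ℓ + 1) ^ jD' : ℕ) : ℝ)) ^ 2)⁻¹ ^ 2 * (∑ z ∈ Finset.univ.filter (fun z : SiteY i => (bondT i.D).dist (blkOf i.D.toDomains z) s ≤ r + 2), ∑ a, ∑ b, ‖GsqY i (parSymY i) D U (cutMulY h Φ) z a b‖ ^ 2)))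
        + 4 * (8 * ((d : ℝ) + 1) * κχ ^ 2 * (2 * (2 * (∑ z ∈ Finset.univ.filter (fun z : SiteY i => (bondT i.D).dist (blkOf i.D.toDomains z) s ≤ r + 2), ∑ μ : Fin (d + 1), ∑ a, ∑ b, ‖cdS i U μ (GsqY i (parSymY i) D U (cutMulY h Φ)) z a b‖ ^ 2) + 2 * ((d : ℝ) + 1) * κ ^ 2 * (∑ z ∈ Finset.univ.filter (fun z : SiteY i => (bondT i.D).dist (blkOf i.D.toDomains z) s ≤ r + 2), ∑ a, ∑ b, ‖GsqY i (parSymY i) D U (cutMulY h Φ) z a b‖ ^ 2))) + 4 * (((d : ℝ) + 1) * κχ₂) ^ 2 * (∑ z ∈ Finset.univ.filter (fun z : SiteY i => (bondT i.D).dist (blkOf i.D.toDomains z) s ≤ r + 2), ∑ a, ∑ b, ‖GsqY i (parSymY i) D U (cutMulY h Φ) z a b‖ ^ 2) + 2 * κχb ^ 2 * ((((((ℓ + 1) ^ jD' : ℕ) : ℝ)) ^ 2)⁻¹ ^ 2 * (∑ z ∈ Finset.univ.filter (fun z : SiteY i => (bondT i.D).dist (blkOf i.D.toDomains z) s ≤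 r + 2), ∑ a, ∑ b, ‖GsqY i (parSymY i) D U (cutMulY h Φ) z a b‖ ^ 2)))
        + 2 * ((((((ℓ + 1) ^ jD' : ℕ) : ℝ)) ^ 2)⁻¹ ^ 2 * (∑ z ∈ Finset.univ.filter (fun z : SiteY i => (bondT i.D).dist (blkOf i.D.toDomains z) s ≤ r + 2), ∑ a, ∑ b, ‖GsqY i (parSymY i) D U (cutMulY h Φ) z a b‖ ^ 2))
        + (((d : ℝ) + 1) ^ 2 * (4 * (εD ^ 2 * (∑ z ∈ Finset.univ.filter (fun z : SiteY i => (bondT i.D).dist (blkOf i.D.toDomains z) s ≤ r + 2), ∑ a, ∑ b, ‖GsqY i (parSymY i) D U (cutMulY h Φ) z a b‖ ^ 2)))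
          + 2 * ((d : ℝ) + 1) * εD * (2 * (2 * (∑ z ∈ Finset.univ.filter (fun z : SiteY i => (bondT i.D).dist (blkOf i.D.toDomains z) s ≤ r + 2), ∑ μ : Fin (d + 1), ∑ a, ∑ b, ‖cdS i U μ (GsqY i (parSymY i) D U (cutMulY h Φ)) z a b‖ ^ 2) + 2 * ((d : ℝ) + 1) * κ ^ 2 * (∑ z ∈ Finset.univ.filter (fun z : SiteY i => (bondT i.D).dist (blkOf i.D.toDomains z) s ≤ r + 2), ∑ a, ∑ b, ‖GsqY i (parSymY i) D U (cutMulY h Φ) z a b‖ ^ 2)) + 2 * ((d : ℝ) + 1) * κχ ^ 2 * (∑ z ∈ Finset.univ.filter (fun z : SiteY i => (bondT i.D).dist (blkOf i.D.toDomains z) s ≤ r + 2), ∑ a, ∑ b, ‖GsqY i (parSymY i) D U (cutMulY h Φ) z a b‖ ^ 2))))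
      ≤ 4 / 3 * (4 * (8 * ((d : ℝ) + 1) * κ ^ 2 * (2 * (160 * (((((ℓ + 1) ^ jD : ℕ) : ℝ)) ^ 2 / Real.exp ((1 / (4 * ((d : ℝ) + 2))) * (((((bondT i.D).dist t s - (r + 2) : ℕ) : ℝ) - 1) / (2 * ((ℓ + 1 : ℕ) : ℝ)))) ^ 2) * trIP (fun _ => (1 : ℝ)) Φ Φ)) + 4 * (((d : ℝ) + 1) * κ₂) ^ 2 * (256 * (((((ℓ + 1) ^ jD : ℕ) : ℝ)) ^ 2 * ((((ℓ + 1) ^ jD : ℕ) : ℝ)) ^ 2 / Real.exp ((1 / (4 * ((d : ℝ) + 2))) * (((((bondT i.D).dist t s - (r + 2) : ℕ) : ℝ) - 1) / (2 * ((ℓ + 1 : ℕ) : ℝ)))) ^ 2) * trIP (fun _ => (1 : ℝ)) Φ Φ) + 2 * κb ^ 2 * ((((((ℓ + 1) ^ jD' : ℕ) : ℝ)) ^ 2)⁻¹ ^ 2 * (256 * (((((ℓ + 1) ^ jD : ℕ) : ℝ)) ^ 2 * ((((ℓ + 1) ^ jD : ℕ) : ℝ)) ^ 2 / Real.exp ((1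 / (4 * ((d : ℝ) + 2))) * (((((bondT i.D).dist t s - (r + 2) : ℕ) : ℝ) - 1) / (2 * ((ℓ + 1 : ℕ) : ℝ)))) ^ 2) * trIP (fun _ => (1 : ℝ)) Φ Φ)))
        + 4 * (8 * ((d : ℝ) + 1) * κχ ^ 2 * (2 * (2 * (160 * (((((ℓ + 1) ^ jD : ℕ) : ℝ)) ^ 2 / Real.exp ((1 / (4 * ((d : ℝ) + 2))) * (((((bondT i.D).dist t s - (r + 2) : ℕ) : ℝ) - 1) / (2 * ((ℓ + 1 : ℕ) : ℝ)))) ^ 2) * trIP (fun _ => (1 : ℝ)) Φ Φ) + 2 * ((d : ℝ) + 1) * κ ^ 2 * (256 * (((((ℓ + 1) ^ jD : ℕ) : ℝ)) ^ 2 * ((((ℓ + 1) ^ jD : ℕ) : ℝ)) ^ 2 / Real.exp ((1 / (4 * ((d : ℝ) + 2))) * (((((bondT i.D).dist t s - (r + 2) : ℕ) : ℝ) - 1) / (2 * ((ℓ + 1 : ℕ) : ℝ)))) ^ 2) * trIP (fun _ => (1 : ℝ)) Φ Φ))) + 4 * (((d : ℝ) + 1) * κχ₂) ^ 2 * (256 *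 (((((ℓ + 1) ^ jD : ℕ) : ℝ)) ^ 2 * ((((ℓ + 1) ^ jD : ℕ) : ℝ)) ^ 2 / Real.exp ((1 / (4 * ((d : ℝ) + 2))) * (((((bondT i.D).dist t s - (r + 2) : ℕ) : ℝ) - 1) / (2 * ((ℓ + 1 : ℕ) : ℝ)))) ^ 2) * trIP (fun _ => (1 : ℝ)) Φ Φ) + 2 * κχb ^ 2 * ((((((ℓ + 1) ^ jD' : ℕ) : ℝ)) ^ 2)⁻¹ ^ 2 * (256 * (((((ℓ + 1) ^ jD : ℕ) : ℝ)) ^ 2 * ((((ℓ + 1) ^ jD : ℕ) : ℝ)) ^ 2 / Real.exp ((1 / (4 * ((d : ℝ) + 2))) * (((((bondT i.D).dist t s - (r + 2) : ℕ) : ℝ) - 1) / (2 * ((ℓ + 1 : ℕ) : ℝ)))) ^ 2) * trIP (fun _ => (1 : ℝ)) Φ Φ)))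
        + 2 * ((((((ℓ + 1) ^ jD' : ℕ) : ℝ)) ^ 2)⁻¹ ^ 2 * (256 * (((((ℓ + 1) ^ jD : ℕ) : ℝ)) ^ 2 * ((((ℓ + 1) ^ jD : ℕ) : ℝ)) ^ 2 / Real.exp ((1 / (4 * ((d : ℝ) + 2))) * (((((bondT i.D).dist t s - (r + 2) : ℕ) : ℝ) - 1) / (2 * ((ℓ + 1 : ℕ) : ℝ)))) ^ 2) * trIP (fun _ => (1 : ℝ)) Φ Φ))
        + (((d : ℝ) + 1) ^ 2 * (4 * (εD ^ 2 * (256 * (((((ℓ + 1) ^ jD : ℕ) : ℝ)) ^ 2 * ((((ℓ + 1) ^ jD : ℕ) : ℝ)) ^ 2 / Real.exp ((1 / (4 * ((d : ℝ) + 2))) * (((((bondT i.D).dist t s - (r + 2) : ℕ) : ℝ) - 1) / (2 * ((ℓ + 1 : ℕ) : ℝ)))) ^ 2) * trIP (fun _ => (1 : ℝ)) Φ Φ)))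
          + 2 * ((d : ℝ) + 1) * εD * (2 * (2 * (160 * (((((ℓ + 1) ^ jD : ℕ) : ℝ)) ^ 2 / Real.exp ((1 / (4 * ((d : ℝ) + 2))) * (((((bondT i.D).dist t s - (r + 2) : ℕ) : ℝ) - 1) / (2 * ((ℓ + 1 : ℕ) : ℝ)))) ^ 2) * trIP (fun _ => (1 : ℝ)) Φ Φ) + 2 * ((d : ℝ) + 1) * κ ^ 2 * (256 * (((((ℓ + 1) ^ jD : ℕ) : ℝ)) ^ 2 * ((((ℓ + 1) ^ jD : ℕ) : ℝ)) ^ 2 / Real.exp ((1 / (4 * ((d : ℝ) + 2))) * (((((bondT i.D).dist t s - (r + 2) : ℕ) : ℝ) - 1) / (2 * ((ℓ + 1 : ℕ) : ℝ)))) ^ 2) * trIP (fun _ => (1 : ℝ)) Φ Φ)) + 2 * ((d : ℝ) + 1) * κχ ^ 2 * (256 * (((((ℓ + 1) ^ jD : ℕ) : ℝ)) ^ 2 * ((((ℓ + 1) ^ jD : ℕ) : ℝ)) ^ 2 / Real.exp ((1 / (4 * ((d : ℝ) + 2))) * (((((bondT i.D).dist t s - (r + 2) : ℕ) : ℝ)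 - 1) / (2 * ((ℓ + 1 : ℕ) : ℝ)))) ^ 2) * trIP (fun _ => (1 : ℝ)) Φ Φ)))) := by
    refine mul_le_mul_of_nonneg_left ?_ h43
    gcongr
  refine hA.trans (hmono.trans (le_of_eq ?_))
  ring

end Far

end Literature.MathematicalPhysics.QuantumFieldTheory.Balaban1983to89.B9Thm31SiteGsqHessianDecayReg335Y

end
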